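import Literature.AlgebraicGeometry.Resolution.SpreadModelData
import HarnessLib

/-!
# Model data over a basic open of the base, and its restriction

Topic: `Literature/AlgebraicGeometry/Resolution`. Glue between the spreading lemmas (which give
properties of a family `q : X → Spec A` at the POINTS over a basic open `D(a)`) and the global
model data `CentreSeq.ModelData` consumed by the fibre-side theorem
`CentreSeq.ModelData.isResolutionOf_comap` (`SpreadModelData.lean`), for the spreading-out
argument of `SpreadsShapedFromGenericPoint` (`CanonicalResolutionSpread.lean`).

* `CentreSeq.ModelDataAt a q jK s 𝓘 E` — **model data over `D(a)`**, a recursive predicate on a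
  multiple blow-up `s` of `X` with generic fibre `jK : X_K → X`: at the points over `D(a)`, the
  stalkwise forms of `𝓘 ⊆ C`, of the smoothness of the saturated strata
  `V(satCentre C B ⊔ ∑_{K∈T} K)`, of the Cartier locus of the members `D₀ ∈ B` on them and of
  the smoothness of their zero schemes — for the finite sets `B, T ⊆ E` on which the generic
  restriction `jK^*` is injective and separates `D₀` from `T` (the cases in which these hold
  generically) —, of the smoothness of the exceptional divisor, of the strict transforms of the
  members of `E` (or their triviality), together with the injectivity clause "members of `E` with
  the same generic restriction have the same stalks over `D(a)`"; recursively along the blow-up.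
* `CentreSeq.ModelDataAt.modelData_restrict` — **restriction to `X₀ = q⁻¹D(a)`** (more generally
  along an open immersion `j` whose image is the set of points over `D(a)`): the restricted
  sequence `s|X₀` carries `ModelData` for `(j ≫ q, j^*𝓘, j^*E)`. The finite sets of members of
  `j^*E` are realised by SECTIONS of `j^*` on `E`, on which the side conditions hold by the
  injectivity clause; pointwise properties become global ones by the packaging lemmas of
  `SpreadRestrict.lean`; the tail is handled along `Bl(j)` (`blowup.map`, an open immersion with
  image the preimage of the image of `j`), using the flat base change formulas for controlled and
  strict transforms (`MarkedIdealsEtale.lean`).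

## Sources

* A. Grothendieck, J. Dieudonné, EGA IV₃ (1966), §8–§9 (spreading out over a dense open of the
  base). [folklore]
* E. Bierstone, D. Grigoriev, P. Milman, J. Włodarczyk, arXiv:1206.3090, Def. 3.1.3.
  [BierstoneGrigorievMilmanWlodarczyk2011]
-/

noncomputable section

open CategoryTheory CategoryTheory.Limits AlgebraicGeometry TopologicalSpace PrimeSpectrum

namespace Literature.AlgebraicGeometry.Resolution

universe u

open Scheme.IdealSheafData

namespace CentreSeq

variable {A : Type u} [CommRing A] (a : A)

/-- **Model data over the basic open `D(a)`** (pointwise form of `ModelData` at the points over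
`D(a)`, relative to the generic fibre `jK`; see the module docstring).
[cite: BierstoneGrigorievMilmanWlodarczyk2011, Def. 3.1.3 with Lemma 3.2.1] -/
def ModelDataAt : {X XK : Scheme.{u}} → (X ⟶ Spec (.of A)) → (XK ⟶ X) → CentreSeq X →
    X.IdealSheafData → List X.IdealSheafData → Prop
  | _, _, q, _, nil _, 𝓘, _ => ∀ x, q x ∈ (basicOpen a : Set (PrimeSpectrum A)) → stalkIdeal 𝓘 x = ⊤
  | X, _, q, jK, cons C rest, 𝓘, E =>
      (∀ D ∈ E, ∀ D' ∈ E, D.comap jK = D'.comap jK →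
        ∀ x : X, q x ∈ (basicOpen a : Set (PrimeSpectrum A)) → stalkIdeal D x = stalkIdeal D' x) ∧
      (∀ x : X, q x ∈ (basicOpen a : Set (PrimeSpectrum A)) → stalkIdeal 𝓘 x ≤ stalkIdeal C x) ∧
      (∀ B T : Finset X.IdealSheafData, (∀ K ∈ B, K ∈ E) → (∀ K ∈ T, K ∈ E) →
        Set.InjOn (fun D : X.IdealSheafData => D.comap jK) B →
        ∀ z : (satCentre C B ⊔ T.sup id).subscheme,
          ((satCentre C B ⊔ T.sup id).subschemeι ≫ q) z ∈ (basicOpen a : Set (PrimeSpectrum A)) →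
          (((satCentre C B ⊔ T.sup id).subschemeι ≫ q).stalkMap z).hom.FormallySmooth) ∧
      (∀ B T : Finset X.IdealSheafData, (∀ K ∈ B, K ∈ E) → (∀ K ∈ T, K ∈ E) →
        Set.InjOn (fun D : X.IdealSheafData => D.comap jK) B →
        ∀ D₀ ∈ E, D₀ ∈ B → (∀ K ∈ T, K.comap jK ≠ D₀.comap jK) →
          (∀ z : (satCentre C B ⊔ T.sup id).subscheme,
            ((satCentre C B ⊔ T.sup id).subschemeι ≫ q) z ∈ (basicOpen a : Set (PrimeSpectrum A)) →
            z ∈ cartierLocus (D₀.comap (satCentre C B ⊔ T.sup id).subschemeι)) ∧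
          (∀ z : (D₀.comap (satCentre C B ⊔ T.sup id).subschemeι).subscheme,
            ((D₀.comap (satCentre C B ⊔ T.sup id).subschemeι).subschemeι ≫
                (satCentre C B ⊔ T.sup id).subschemeι ≫ q) z ∈ (basicOpen a : Set (PrimeSpectrum A)) →
            (((D₀.comap (satCentre C B ⊔ T.sup id).subschemeι).subschemeι ≫
              (satCentre C B ⊔ T.sup id).subschemeι ≫ q).stalkMap z).hom.FormallySmooth)) ∧
      (∀ z : (C.comap (blowup.π C)).subscheme,
        ((C.comap (blowup.π C)).subschemeι ≫ blowup.π C ≫ q) z ∈ (basicOpen a : Set (PrimeSpectrum A)) →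
        (((C.comap (blowup.π C)).subschemeι ≫ blowup.π C ≫ q).stalkMap z).hom.FormallySmooth) ∧
      (∀ K ∈ E,
        ((∀ z : (strictTransformIdeal (blowup.π C) C K).subscheme,
            ((strictTransformIdeal (blowup.π C) C K).subschemeι ≫ blowup.π C ≫ q) z ∈
                (basicOpen a : Set (PrimeSpectrum A)) →
            (((strictTransformIdeal (blowup.π C) C K).subschemeι ≫ blowup.π C ≫ q).stalkMap z).hom.FormallySmooth) ∧
          (∀ z : (strictTransformIdeal (blowup.π C) C K).subscheme,
            ((strictTransformIdeal (blowup.π C) C K).subschemeι ≫ blowup.π C ≫ q) z ∈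
                (basicOpen a : Set (PrimeSpectrum A)) →
            z ∈ cartierLocus ((C.comap (blowup.π C)).comap
              (strictTransformIdeal (blowup.π C) C K).subschemeι)) ∧
          (∀ z : ((C.comap (blowup.π C)).comap (strictTransformIdeal (blowup.π C) C K).subschemeι).subscheme,
            ((((C.comap (blowup.π C)).comap
              (strictTransformIdeal (blowup.π C) C K).subschemeι)).subschemeι ≫
                (strictTransformIdeal (blowup.π C) C K).subschemeι ≫ blowup.π C ≫ q) z ∈
                (basicOpen a : Set (PrimeSpectrum A)) →
            (((((C.comap (blowup.π C)).comap
              (strictTransformIdeal (blowup.π C) C K).subschemeι)).subschemeι ≫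
                (strictTransformIdeal (blowup.π C) C K).subschemeι ≫ blowup.π C ≫ q).stalkMap z).hom.FormallySmooth)) ∨
        (∀ x : blowup C, (blowup.π C ≫ q) x ∈ (basicOpen a : Set (PrimeSpectrum A)) →
          stalkIdeal (strictTransformIdeal (blowup.π C) C K) x = ⊤)) ∧
      ModelDataAt (blowup.π C ≫ q) (blowup.comapMap C jK) rest
        (controlledTransform (blowup.π C) C 𝓘 1)
        (E.map (strictTransformIdeal (blowup.π C) C) ++ [C.comap (blowup.π C)])

/-! ## Restriction along an open immersion covering the points over `D(a)` -/

section Restrict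

variable {X X₀ : Scheme.{u}} (j : X₀ ⟶ X)

/-- Ideal sheaves with the same stalks at the points of the image of an open immersion `j` have
the same pull-back along `j`. [folklore] -/
theorem comap_eq_comap_of_forall_stalkIdeal_eq {D D' : X.IdealSheafData}
    (h : ∀ x : X₀, stalkIdeal D (j x) = stalkIdeal D' (j x)) : D.comap j = D'.comap j :=
  ext_of_forall_stalkIdeal_eq fun x => by
    rw [stalkIdeal_comap_eq_map_stalkMap, stalkIdeal_comap_eq_map_stalkMap, h x]

/-- Ideal sheaves with ordered stalks at the points of the image of an open immersion `j` have
ordered pull-backs along `j`. [folklore] -/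
theorem comap_le_comap_of_forall_stalkIdeal_le {D D' : X.IdealSheafData}
    (h : ∀ x : X₀, stalkIdeal D (j x) ≤ stalkIdeal D' (j x)) : D.comap j ≤ D'.comap j :=
  le_of_forall_stalkIdeal_le fun x => by
    rw [stalkIdeal_comap_eq_map_stalkMap, stalkIdeal_comap_eq_map_stalkMap]
    exact Ideal.map_mono (h x)

/-- An ideal sheaf with unit stalks at the points of the image of `j` pulls back to the unit ideal
sheaf. [folklore] -/
theorem comap_eq_top_of_forall_stalkIdeal_eq_top {D : X.IdealSheafData}
    (h : ∀ x : X₀, stalkIdeal D (j x) = ⊤) : D.comap j = ⊤ :=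
  ext_of_forall_stalkIdeal_eq fun x => by
    rw [stalkIdeal_comap_eq_map_stalkMap, h x, Ideal.map_top, stalkIdeal_top]

/-- The closed subscheme of the unit ideal sheaf is empty. [folklore] -/
theorem isEmpty_subscheme_top (Y : Scheme.{u}) : IsEmpty (⊤ : Y.IdealSheafData).subscheme :=
  ⟨fun z => by
    have h := subschemeι_apply_mem_support (⊤ : Y.IdealSheafData) z
    rw [support_top] at h
    exact h⟩

/-- A morphism locally of finite presentation from an empty scheme is smooth. [folklore] -/
theorem smooth_of_isEmpty {Y Z : Scheme.{u}} (f : Y ⟶ Z) [LocallyOfFinitePresentation f]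
    [IsEmpty Y] : Smooth f := by
  rw [← Scheme.Hom.smoothLocus_eq_top_iff]
  exact top_le_iff.mp fun z _ => isEmptyElim z

/-- Every ideal sheaf on an empty scheme is an effective Cartier divisor. [folklore] -/
theorem isEffectiveCartier_of_isEmpty {Y : Scheme.{u}} [IsEmpty Y] (I : Y.IdealSheafData) :
    IsEffectiveCartier I := fun z => isEmptyElim z

/-- **A section of `j^*` on the members of `E`**: every member of `j^*E` is `j^*K` for a chosen
`K ∈ E`. [folklore] -/
theorem exists_section_comap (E : List X.IdealSheafData) :
    ∃ sec : X₀.IdealSheafData → X.IdealSheafData,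
      ∀ D₀ ∈ E.map (fun K => K.comap j), sec D₀ ∈ E ∧ (sec D₀).comap j = D₀ := by
  classical
  refine ⟨fun D₀ => if h : D₀ ∈ E.map (fun K => K.comap j) then (List.mem_map.mp h).choose else ⊤,
    fun D₀ hD₀ => ?_⟩
  simp only [dif_pos hD₀]
  exact (List.mem_map.mp hD₀).choose_spec

end Restrict

/-- **Restriction of model data over `D(a)` to the preimage of `D(a)`** (see the module
docstring): if `s` carries `ModelDataAt a q jK s 𝓘 E` and `j : X₀ → X` is an open immersion whose
image is the set of points of `X` over `D(a)`, then the restricted sequence `s|X₀` carries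
`ModelData (j ≫ q) (s|X₀) (j^*𝓘) (j^*E)`. [cite: BierstoneGrigorievMilmanWlodarczyk2011, Def. 3.1.3 with Lemma 3.2.1] -/
theorem ModelDataAt.modelData_restrict [IsNoetherianRing A] :
    ∀ {X XK : Scheme.{u}} [IsLocallyNoetherian X] (s : CentreSeq X) (q : X ⟶ Spec (.of A))
      [LocallyOfFiniteType q] (jK : XK ⟶ X) (𝓘 : X.IdealSheafData) (E : List X.IdealSheafData),
      ModelDataAt a q jK s 𝓘 E →
      ∀ {X₀ : Scheme.{u}} (j : X₀ ⟶ X) [IsOpenImmersion j],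
        (∀ x : X, x ∈ Set.range j ↔ q x ∈ (basicOpen a : Set (PrimeSpectrum A))) →
        ModelData (j ≫ q) (s.restrict j) (𝓘.comap j) (E.map fun K => K.comap j)
  | X, _, _, nil _, q, _, jK, 𝓘, E, h, X₀, j, _, hj => by
    show 𝓘.comap j = ⊤
    exact comap_eq_top_of_forall_stalkIdeal_eq_top j fun x => h (j x) ((hj (j x)).mp ⟨x, rfl⟩)
  | X, XK, _, cons C rest, q, _, jK, 𝓘, E, h, X₀, j, _, hj => by
    classical
    obtain ⟨hinj, hIC, hsm, hcart, hexc, hbd, hrest⟩ := h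
    haveI : IsLocallyNoetherian X₀ := LocallyOfFiniteType.isLocallyNoetherian j
    haveI : IsProper (blowup.π C) := (blowup.isBlowup C).isProper
    haveI : IsLocallyNoetherian (blowup C) := LocallyOfFiniteType.isLocallyNoetherian (blowup.π C)
    haveI : IsProper (blowup.π (C.comap j)) := (blowup.isBlowup (C.comap j)).isProper
    haveI : IsLocallyNoetherian (blowup (C.comap j)) :=
      LocallyOfFiniteType.isLocallyNoetherian (blowup.π (C.comap j))
    -- notation
    set E₀ : List X₀.IdealSheafData := E.map fun K => K.comap j with hE₀
    set C₀ : X₀.IdealSheafData := C.comap j with hC₀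
    set j₁ : blowup (C.comap j) ⟶ blowup C := blowup.map C j with hj₁
    have hj₁range : ∀ x : blowup C, x ∈ Set.range j₁ ↔
        (blowup.π C ≫ q) x ∈ (basicOpen a : Set (PrimeSpectrum A)) := fun x => by
      rw [hj₁, blowup.range_map, Set.mem_preimage, hj, Scheme.Hom.comp_apply]
    have hsq : j₁ ≫ blowup.π C = blowup.π (C.comap j) ≫ j := blowup.map_π C j
    -- points of `X₀` lie over `D(a)`
    have hjx : ∀ x : X₀, q (j x) ∈ (basicOpen a : Set (PrimeSpectrum A)) := fun x =>
      (hj (j x)).mp ⟨x, rfl⟩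
    -- a section of `j^*` on `E`
    obtain ⟨sec, hsec⟩ := exists_section_comap j E
    -- members of `E₀` with equal generic restriction after `sec`... : injectivity of `j^*` modulo `jK^*`
    have hsecinj : ∀ D₀ ∈ E₀, ∀ D₀' ∈ E₀, (sec D₀).comap jK = (sec D₀').comap jK → D₀ = D₀' := by
      intro D₀ hD₀ D₀' hD₀' heq
      rw [← (hsec D₀ hD₀).2, ← (hsec D₀' hD₀').2]
      exact comap_eq_comap_of_forall_stalkIdeal_eq j fun x =>
        hinj _ (hsec D₀ hD₀).1 _ (hsec D₀' hD₀').1 heq (j x) (hjx x)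
    -- finite presentation of the structure maps (Noetherian base)
    have hlofp : ∀ {Y : Scheme.{u}} (g : Y ⟶ Spec (.of A)) [LocallyOfFiniteType g],
        LocallyOfFinitePresentation g := fun g _ => locallyOfFinitePresentation_of_isNoetherianRing_base g
    refine ⟨?_, ?_, ?_, ?_, ?_, ?_⟩
    · -- `𝓘 ⊆ C` on `X₀`
      exact comap_le_comap_of_forall_stalkIdeal_le j fun x => hIC (j x) (hjx x)
    · -- smooth saturated strata
      intro B₀ T₀ hB₀ hT₀
      set B : Finset X.IdealSheafData := B₀.image sec with hB
      set T : Finset X.IdealSheafData := T₀.image sec with hT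
      have hBE : ∀ K ∈ B, K ∈ E := fun K hK => by
        obtain ⟨D₀, hD₀, rfl⟩ := Finset.mem_image.mp hK
        exact (hsec D₀ (hB₀ D₀ hD₀)).1
      have hTE : ∀ K ∈ T, K ∈ E := fun K hK => by
        obtain ⟨D₀, hD₀, rfl⟩ := Finset.mem_image.mp hK
        exact (hsec D₀ (hT₀ D₀ hD₀)).1
      have hinjB : Set.InjOn (fun D : X.IdealSheafData => D.comap jK) B := by
        intro D hD D' hD' heq
        obtain ⟨D₀, hD₀, rfl⟩ := Finset.mem_image.mp hD
        obtain ⟨D₀', hD₀', rfl⟩ := Finset.mem_image.mp hD'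
        rw [hsecinj D₀ (hB₀ D₀ hD₀) D₀' (hB₀ D₀' hD₀') heq]
      have hinjB' : Set.InjOn (fun D : X.IdealSheafData => D.comap j) B := by
        intro D hD D' hD' heq
        obtain ⟨D₀, hD₀, rfl⟩ := Finset.mem_image.mp hD
        obtain ⟨D₀', hD₀', rfl⟩ := Finset.mem_image.mp hD'
        have heq' : D₀ = D₀' := by
          rw [← (hsec D₀ (hB₀ D₀ hD₀)).2, ← (hsec D₀' (hB₀ D₀' hD₀')).2]
          exact heq
        rw [heq']
      have hBimg : B.image (fun D => D.comap j) = B₀ := by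
        ext D₀
        simp only [hB, Finset.mem_image]
        constructor
        · rintro ⟨_, ⟨D₀', hD₀', rfl⟩, rfl⟩
          rw [(hsec D₀' (hB₀ D₀' hD₀')).2]
          exact hD₀'
        · intro hD₀
          exact ⟨sec D₀, ⟨D₀, hD₀, rfl⟩, (hsec D₀ (hB₀ D₀ hD₀)).2⟩
      have hTimg : T.image (fun D => D.comap j) = T₀ := by
        ext D₀
        simp only [hT, Finset.mem_image]
        constructor
        · rintro ⟨_, ⟨D₀', hD₀', rfl⟩, rfl⟩
          rw [(hsec D₀' (hT₀ D₀' hD₀')).2]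
          exact hD₀'
        · intro hD₀
          exact ⟨sec D₀, ⟨D₀, hD₀, rfl⟩, (hsec D₀ (hT₀ D₀ hD₀)).2⟩
      have hV : (satCentre C B ⊔ T.sup id).comap j = satCentre C₀ B₀ ⊔ T₀.sup id := by
        rw [comap_satCentre_sup_finsetSup j C B T hinjB', hBimg, hTimg]
      haveI := hlofp ((satCentre C B ⊔ T.sup id).subschemeι ≫ q)
      have key := smooth_comap_subschemeι_comp_of_forall_mem_smoothLocus q j (satCentre C B ⊔ T.sup id)
        fun z hz => Scheme.Hom.mem_smoothLocus.mpr (hsm B T hBE hTE hinjB z ((hj _).mp hz))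
      rw [hV] at key
      exact key
    · -- relative Cartier members and smooth zero schemes
      intro B₀ T₀ hB₀ hT₀ D₀' hD₀'E hD₀'B hD₀'T
      set B : Finset X.IdealSheafData := B₀.image sec with hB
      set T : Finset X.IdealSheafData := T₀.image sec with hT
      set D₀ : X.IdealSheafData := sec D₀' with hD₀
      have hBE : ∀ K ∈ B, K ∈ E := fun K hK => by
        obtain ⟨D₁, hD₁, rfl⟩ := Finset.mem_image.mp hK
        exact (hsec D₁ (hB₀ D₁ hD₁)).1
      have hTE : ∀ K ∈ T, K ∈ E := fun K hK => by
        obtain ⟨D₁, hD₁, rfl⟩ := Finset.mem_image.mp hK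
        exact (hsec D₁ (hT₀ D₁ hD₁)).1
      have hinjB : Set.InjOn (fun D : X.IdealSheafData => D.comap jK) B := by
        intro D hD D' hD' heq
        obtain ⟨D₁, hD₁, rfl⟩ := Finset.mem_image.mp hD
        obtain ⟨D₁', hD₁', rfl⟩ := Finset.mem_image.mp hD'
        rw [hsecinj D₁ (hB₀ D₁ hD₁) D₁' (hB₀ D₁' hD₁') heq]
      have hinjB' : Set.InjOn (fun D : X.IdealSheafData => D.comap j) B := by
        intro D hD D' hD' heq
        obtain ⟨D₁, hD₁, rfl⟩ := Finset.mem_image.mp hD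
        obtain ⟨D₁', hD₁', rfl⟩ := Finset.mem_image.mp hD'
        have heq' : D₁ = D₁' := by
          rw [← (hsec D₁ (hB₀ D₁ hD₁)).2, ← (hsec D₁' (hB₀ D₁' hD₁')).2]
          exact heq
        rw [heq']
      have hBimg : B.image (fun D => D.comap j) = B₀ := by
        ext D₁
        simp only [hB, Finset.mem_image]
        constructor
        · rintro ⟨_, ⟨D₁', hD₁', rfl⟩, rfl⟩
          rw [(hsec D₁' (hB₀ D₁' hD₁')).2]
          exact hD₁'
        · intro hD₁
          exact ⟨sec D₁, ⟨D₁, hD₁, rfl⟩, (hsec D₁ (hB₀ D₁ hD₁)).2⟩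
      have hTimg : T.image (fun D => D.comap j) = T₀ := by
        ext D₁
        simp only [hT, Finset.mem_image]
        constructor
        · rintro ⟨_, ⟨D₁', hD₁', rfl⟩, rfl⟩
          rw [(hsec D₁' (hT₀ D₁' hD₁')).2]
          exact hD₁'
        · intro hD₁
          exact ⟨sec D₁, ⟨D₁, hD₁, rfl⟩, (hsec D₁ (hT₀ D₁ hD₁)).2⟩
      have hD₀E : D₀ ∈ E := (hsec D₀' hD₀'E).1
      have hD₀j : D₀.comap j = D₀' := (hsec D₀' hD₀'E).2
      have hD₀B : D₀ ∈ B := Finset.mem_image.mpr ⟨D₀', hD₀'B, rfl⟩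
      have hD₀T : ∀ K ∈ T, K.comap jK ≠ D₀.comap jK := by
        intro K hK heq
        obtain ⟨D₁, hD₁, rfl⟩ := Finset.mem_image.mp hK
        have := hsecinj D₁ (hT₀ D₁ hD₁) D₀' hD₀'E heq
        exact hD₀'T (this ▸ hD₁)
      have hV : (satCentre C B ⊔ T.sup id).comap j = satCentre C₀ B₀ ⊔ T₀.sup id := by
        rw [comap_satCentre_sup_finsetSup j C B T hinjB', hBimg, hTimg]
      obtain ⟨hc, hs⟩ := hcart B T hBE hTE hinjB D₀ hD₀E hD₀B hD₀T
      refine ⟨?_, ?_⟩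
      · have key := isEffectiveCartier_comap_comap_subschemeι_of_forall_mem_cartierLocus j
          (satCentre C B ⊔ T.sup id) D₀ fun z hz => hc z ((hj _).mp hz)
        rw [hV, hD₀j] at key
        exact key
      · haveI := hlofp ((D₀.comap (satCentre C B ⊔ T.sup id).subschemeι).subschemeι ≫
          (satCentre C B ⊔ T.sup id).subschemeι ≫ q)
        have key := smooth_zeroScheme_comap_of_forall_mem_smoothLocus q j (satCentre C B ⊔ T.sup id) D₀
          fun z hz => Scheme.Hom.mem_smoothLocus.mpr (hs z ((hj _).mp hz))
        rw [hV, hD₀j] at key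
        exact key
    · -- smooth exceptional divisor
      haveI := hlofp ((C.comap (blowup.π C)).subschemeι ≫ blowup.π C ≫ q)
      have key := smooth_comap_subschemeι_comp_of_forall_mem_smoothLocus (blowup.π C ≫ q) j₁
        (C.comap (blowup.π C)) fun z hz => Scheme.Hom.mem_smoothLocus.mpr (hexc z ((hj₁range _).mp hz))
      have he : (C.comap (blowup.π C)).comap j₁ = C₀.comap (blowup.π (C.comap j)) := by
        rw [hC₀, ← Scheme.IdealSheafData.comap_comp, ← Scheme.IdealSheafData.comap_comp, hsq]
      rw [he, reassoc_of% hsq] at key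
      exact key
    · -- strict transforms of the members of `E₀`
      intro K₀ hK₀
      set K : X.IdealSheafData := sec K₀ with hKdef
      have hKE : K ∈ E := (hsec K₀ hK₀).1
      have hKj : K.comap j = K₀ := (hsec K₀ hK₀).2
      have hS : (strictTransformIdeal (blowup.π C) C K).comap j₁ =
          strictTransformIdeal (blowup.π (C.comap j)) C₀ K₀ := by
        rw [comap_strictTransformIdeal_of_flat j hsq, hKj]
      have he : (C.comap (blowup.π C)).comap j₁ = C₀.comap (blowup.π (C.comap j)) := by
        rw [hC₀, ← Scheme.IdealSheafData.comap_comp, ← Scheme.IdealSheafData.comap_comp, hsq]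
      rcases hbd K hKE with ⟨hsmK, hcartK, hzsK⟩ | htop
      · haveI := hlofp ((strictTransformIdeal (blowup.π C) C K).subschemeι ≫ blowup.π C ≫ q)
        haveI := hlofp ((((C.comap (blowup.π C)).comap
          (strictTransformIdeal (blowup.π C) C K).subschemeι)).subschemeι ≫
            (strictTransformIdeal (blowup.π C) C K).subschemeι ≫ blowup.π C ≫ q)
        have k1 := smooth_comap_subschemeι_comp_of_forall_mem_smoothLocus (blowup.π C ≫ q) j₁
          (strictTransformIdeal (blowup.π C) C K) fun z hz => Scheme.Hom.mem_smoothLocus.mpr (hsmK z ((hj₁range _).mp hz))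
        have k2 := isEffectiveCartier_comap_comap_subschemeι_of_forall_mem_cartierLocus j₁
          (strictTransformIdeal (blowup.π C) C K) (C.comap (blowup.π C))
          fun z hz => hcartK z ((hj₁range _).mp hz)
        have k3 := smooth_zeroScheme_comap_of_forall_mem_smoothLocus (blowup.π C ≫ q) j₁
          (strictTransformIdeal (blowup.π C) C K) (C.comap (blowup.π C))
          fun z hz => Scheme.Hom.mem_smoothLocus.mpr (hzsK z ((hj₁range _).mp hz))
        rw [hS, reassoc_of% hsq] at k1
        rw [hS, he] at k2
        rw [hS, he, reassoc_of% hsq] at k3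
        exact ⟨k1, k2, k3⟩
      · -- the strict transform is trivial over `D(a)`
        have hStop : strictTransformIdeal (blowup.π (C.comap j)) C₀ K₀ = ⊤ := by
          rw [← hS]
          exact comap_eq_top_of_forall_stalkIdeal_eq_top j₁ fun x =>
            htop (j₁ x) ((hj₁range _).mp ⟨x, rfl⟩)
        rw [hStop]
        haveI := isEmpty_subscheme_top (blowup (C.comap j))
        haveI := hlofp ((⊤ : (blowup (C.comap j)).IdealSheafData).subschemeι ≫
          blowup.π (C.comap j) ≫ j ≫ q)
        refine ⟨smooth_of_isEmpty _, isEffectiveCartier_of_isEmpty _, ?_⟩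
        haveI : IsEmpty (((C₀.comap (blowup.π (C.comap j))).comap
            (⊤ : (blowup (C.comap j)).IdealSheafData).subschemeι)).subscheme :=
          ⟨fun z => isEmptyElim ((((C₀.comap (blowup.π (C.comap j))).comap
            (⊤ : (blowup (C.comap j)).IdealSheafData).subschemeι)).subschemeι z)⟩
        haveI := hlofp ((((C₀.comap (blowup.π (C.comap j))).comap
            (⊤ : (blowup (C.comap j)).IdealSheafData).subschemeι)).subschemeι ≫
          (⊤ : (blowup (C.comap j)).IdealSheafData).subschemeι ≫ blowup.π (C.comap j) ≫ j ≫ q)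
        exact smooth_of_isEmpty _
    · -- the tail, along `Bl(j)`
      have ih := ModelDataAt.modelData_restrict rest (blowup.π C ≫ q) (blowup.comapMap C jK)
        (controlledTransform (blowup.π C) C 𝓘 1)
        (E.map (strictTransformIdeal (blowup.π C) C) ++ [C.comap (blowup.π C)]) hrest j₁ hj₁range
      have h𝓘 : (controlledTransform (blowup.π C) C 𝓘 1).comap j₁ =
          controlledTransform (blowup.π (C.comap j)) C₀ (𝓘.comap j) 1 :=
        comap_controlledTransform_of_flat j hsq C 𝓘 1
      have hE : (E.map (strictTransformIdeal (blowup.π C) C) ++ [C.comap (blowup.π C)]).map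
          (fun K => K.comap j₁) =
          E₀.map (strictTransformIdeal (blowup.π (C.comap j)) C₀) ++ [C₀.comap (blowup.π (C.comap j))] := by
        simp only [hE₀, List.map_append, List.map_map, List.map_cons, List.map_nil]
        congr 1
        · refine List.map_congr_left fun K _ => ?_
          simp only [Function.comp_apply, comap_strictTransformIdeal_of_flat j hsq, hC₀]
        · rw [hC₀, ← Scheme.IdealSheafData.comap_comp, ← Scheme.IdealSheafData.comap_comp, hsq]
      rw [h𝓘, hE, reassoc_of% hsq] at ih
      exact ih

end CentreSeq

end Literature.AlgebraicGeometry.Resolution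

end
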